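import Summits.CriticalPhenomena.PercolationContinuityZ3.Theorems.PercNearOneGluingNoHeavyLowerTailKnQuestion8CoefficientwiseCoreClassKernelMixFull
import HarnessLib

/-!
# KB-SERIES, the contact cell: one root, one observer, external sets — and the reduction to the ONE-SIDED ROOT inequality

Support file (`--supports stmt-CriticalPhenomena-4575`, closed), prover `prim-cplus-coupling` (gen 31).  No definitions, no notations, no named facts,
no sorries; standard axioms.  Memo `prim-cplus-coupling/A5-COUPLING-gen31.md` §2b.  Companion of `…CoreClassSeriesClusters`, `…CoreClassSeriesMain`.

Context.  For a series composition `H = H₁ ·_c H₂` of middle graphs (terminals `a ∈ H₁`, `b ∈ H₂`, cut vertex `c`) the KB-MIX bookkeeping of the wall of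
`H` (memo §2) pays every cell by domination maps of the parts except the CONTACT CELL `C6 = R₁ × B₂` — `a` red-joined (not blue-joined) to `c` in `H₁`,
`b` blue-joined (not red-joined) to `c` in `H₂` — where the pair (red cluster of `a`, blue cluster of `b`) is `(X₁ ∪ X₂, Y₁ ∪ Y₂)`, `Xᵢ, Yᵢ` the red and
blue clusters of the cut vertex in `Hᵢ`.  The supply left for it is `R₁ × R₂` (`b` red-joined to `c`), where `S = X₁ ∪ X₂`.
* `Coefficientwise.oneRoot_transfer` — ONE ROOT `c`, ONE OBSERVER `b`, EXTERNAL SETS `A, A′` (generic graph `E`; `X = C_c ω`, `Y = C_c(E∖ω)`,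
  `R = {b ∈ X ∖ Y}`, `B = {b ∈ Y ∖ X}`): for monotone levels `0 ≤ hᵃ ≤ h`, `0 ≤ kᵃ ≤ k`, `0 ≤ hᵇ, kᵇ`:
  `Σ_R h(A∪X)k(A∪X) + Σ_B (hᵃ(A∪X) − hᵇ(A′∪Y))(kᵃ(A∪X) − kᵇ(A′∪Y)) ≥ Σ_R (h(A∪X) − hᵇ(A′∪X))(k(A∪X) − kᵇ(A′∪X))`
  (swap of the square, ONE two-colouring Harris inequality per cross term: `F = hᵃ(A∪X)` increasing, `G = kᵇ(A′∪X)·1_R` increasing).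
* `Coefficientwise.seriesC6_of_oneSidedRoot` — summing over `ω₁ ∈ R₁` with `A = X₁`, `A′ = Y₁` and exchanging the sums, the contact cell plus the
  `R₁ × R₂` supply is bounded below by `Σ_{η₂ ∈ R₂} OSR(H₁; c, a)[levels shifted by X₂(η₂)]`, hence is `≥ 0` under the
  ONE-SIDED ROOT INEQUALITY for `(H₁; c, a)`:  `∀ H ≥ Hᵇ ≥ 0, K ≥ Kᵇ ≥ 0 monotone: Σ_{a ∈ X₁ ∖ Y₁} (H(X₁) − Hᵇ(Y₁))(K(X₁) − Kᵇ(Y₁)) ≥ 0`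
  (census-clean for all graphs on ≤ 7 vertices; trivially true when `Y₁ ⊆ X₁` on that event, e.g. `a` adjacent to every vertex of `H₁`; memo §2b).
[cite: KozmaNitzan2024, Questions 8–9 (§5.5 p. 36) (context: the Question-8 pocket covariance programme)]
-/

namespace Summit.CriticalPhenomena.PercolationContinuityZ3.Theorems

open Finset Literature.Probability.Percolation

namespace Coefficientwise

variable {ι V : Type*}

open Classical in
/-- **One root, one observer, external sets.**  Graph `E`, root `c`, observer `b`, sets `A, A′ ⊆ V`, monotone `h, k, hᵃ, kᵃ, hᵇ, kᵇ` with
`0 ≤ hᵃ ≤ h`, `0 ≤ kᵃ ≤ k`, `0 ≤ hᵇ`, `0 ≤ kᵇ`; `X = C_c(ω)`, `Y = C_c(E∖ω)`.  Then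
`Σ_{b ∈ X, b ∉ Y} h(A∪X)k(A∪X) + Σ_{b ∈ Y, b ∉ X} (hᵃ(A∪X) − hᵇ(A′∪Y))(kᵃ(A∪X) − kᵇ(A′∪Y)) ≥ Σ_{b ∈ X, b ∉ Y} (h(A∪X) − hᵇ(A′∪X))(k(A∪X) − kᵇ(A′∪X))`.
[cite: KozmaNitzan2024, Questions 8–9 (§5.5 p. 36) (context)] -/
theorem oneRoot_transfer (ends : ι → Sym2 V) (E : Finset ι) (c b : V) (A A' : Set V) (h k ha ka hb kb : Set V → ℝ)
    (mha : Monotone ha) (mka : Monotone ka) (mhb : Monotone hb) (mkb : Monotone kb)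
    (ha0 : ∀ X, 0 ≤ ha X) (hah : ∀ X, ha X ≤ h X) (ka0 : ∀ X, 0 ≤ ka X) (kak : ∀ X, ka X ≤ k X)
    (hb0 : ∀ X, 0 ≤ hb X) (kb0 : ∀ X, 0 ≤ kb X) :
    ∑ ω ∈ E.powerset, (if b ∈ openCluster (ends '' (↑ω : Set ι)) c ∧ b ∉ openCluster (ends '' (↑(E \ ω) : Set ι)) c then
        (h (A ∪ openCluster (ends '' (↑ω : Set ι)) c) - hb (A' ∪ openCluster (ends '' (↑ω : Set ι)) c)) *
          (k (A ∪ openCluster (ends '' (↑ω : Set ι)) c) - kb (A' ∪ openCluster (ends '' (↑ω : Set ι)) c)) else 0)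
    ≤ ∑ ω ∈ E.powerset, ((if b ∈ openCluster (ends '' (↑ω : Set ι)) c ∧ b ∉ openCluster (ends '' (↑(E \ ω) : Set ι)) c then
        h (A ∪ openCluster (ends '' (↑ω : Set ι)) c) * k (A ∪ openCluster (ends '' (↑ω : Set ι)) c) else 0)
      + (if b ∈ openCluster (ends '' (↑(E \ ω) : Set ι)) c ∧ b ∉ openCluster (ends '' (↑ω : Set ι)) c then
        (ha (A ∪ openCluster (ends '' (↑ω : Set ι)) c) - hb (A' ∪ openCluster (ends '' (↑(E \ ω) : Set ι)) c)) *
          (ka (A ∪ openCluster (ends '' (↑ω : Set ι)) c) - kb (A' ∪ openCluster (ends '' (↑(E \ ω) : Set ι)) c)) else 0)) := by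
  set X : Finset ι → Set V := fun ω => openCluster (ends '' (↑ω : Set ι)) c with hX
  change ∑ ω ∈ E.powerset, (if b ∈ X ω ∧ b ∉ X (E \ ω) then (h (A ∪ X ω) - hb (A' ∪ X ω)) * (k (A ∪ X ω) - kb (A' ∪ X ω)) else 0)
    ≤ ∑ ω ∈ E.powerset, ((if b ∈ X ω ∧ b ∉ X (E \ ω) then h (A ∪ X ω) * k (A ∪ X ω) else 0)
      + (if b ∈ X (E \ ω) ∧ b ∉ X ω then (ha (A ∪ X ω) - hb (A' ∪ X (E \ ω))) * (ka (A ∪ X ω) - kb (A' ∪ X (E \ ω))) else 0))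
  have hXmono : ∀ {ω ω' : Finset ι}, ω ⊆ ω' → X ω ⊆ X ω' := fun hle => openCluster_image_mono ends hle c
  -- the square on `B` swaps onto `R`
  have sq : ∑ ω ∈ E.powerset, (if b ∈ X (E \ ω) ∧ b ∉ X ω then hb (A' ∪ X (E \ ω)) * kb (A' ∪ X (E \ ω)) else 0) =
      ∑ ω ∈ E.powerset, (if b ∈ X ω ∧ b ∉ X (E \ ω) then hb (A' ∪ X ω) * kb (A' ∪ X ω) else 0) := by
    have hs : ∑ ω ∈ E.powerset, (if b ∈ X (E \ ω) ∧ b ∉ X (E \ (E \ ω)) then hb (A' ∪ X (E \ ω)) * kb (A' ∪ X (E \ ω)) else 0) =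
        ∑ ω ∈ E.powerset, (if b ∈ X ω ∧ b ∉ X (E \ ω) then hb (A' ∪ X ω) * kb (A' ∪ X ω) else 0) :=
      sum_powerset_sdiff E (fun ω => if b ∈ X ω ∧ b ∉ X (E \ ω) then hb (A' ∪ X ω) * kb (A' ∪ X ω) else 0)
    rw [← hs]
    refine Finset.sum_congr rfl fun ω hω => ?_
    rw [Finset.sdiff_sdiff_eq_self (Finset.mem_powerset.mp hω)]
  -- first cross term: Σ_B hᵃ(A∪X) kᵇ(A′∪Y) ≤ Σ_R hᵃ(A∪X) kᵇ(A′∪X)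
  have cross1 : ∑ ω ∈ E.powerset, (if b ∈ X (E \ ω) ∧ b ∉ X ω then ha (A ∪ X ω) * kb (A' ∪ X (E \ ω)) else 0)
      ≤ ∑ ω ∈ E.powerset, (if b ∈ X ω ∧ b ∉ X (E \ ω) then ha (A ∪ X ω) * kb (A' ∪ X ω) else 0) := by
    set F : Finset ι → ℝ := fun ω => ha (A ∪ X ω) with hF
    set G : Finset ι → ℝ := fun ω => if b ∈ X ω ∧ b ∉ X (E \ ω) then kb (A' ∪ X ω) else 0 with hG
    have hFm : Monotone F := fun ω ω' hle => mha (Set.union_subset_union_right A (hXmono hle))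
    have hGm : Monotone G := by
      intro ω ω' hle
      simp only [hG]
      by_cases h1 : b ∈ X ω ∧ b ∉ X (E \ ω)
      · have h1' : b ∈ X ω' ∧ b ∉ X (E \ ω') := ⟨hXmono hle h1.1, fun hx => h1.2 (hXmono (Finset.sdiff_subset_sdiff (le_refl E) hle) hx)⟩
        rw [if_pos h1, if_pos h1']
        exact mkb (Set.union_subset_union_right A' (hXmono hle))
      · rw [if_neg h1]
        by_cases h2 : b ∈ X ω' ∧ b ∉ X (E \ ω')
        · rw [if_pos h2]; exact kb0 _
        · rw [if_neg h2]
    have key := sum_mul_sdiff_le_sum_mul E F G hFm hGm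
    have lhs : ∑ ω ∈ E.powerset, F ω * G (E \ ω) =
        ∑ ω ∈ E.powerset, (if b ∈ X (E \ ω) ∧ b ∉ X ω then ha (A ∪ X ω) * kb (A' ∪ X (E \ ω)) else 0) := by
      refine Finset.sum_congr rfl fun ω hω => ?_
      simp only [hF, hG]
      rw [Finset.sdiff_sdiff_eq_self (Finset.mem_powerset.mp hω)]
      by_cases h1 : b ∈ X (E \ ω) ∧ b ∉ X ω
      · rw [if_pos h1, if_pos h1]
      · rw [if_neg h1, if_neg h1, mul_zero]
    have rhs : ∑ ω ∈ E.powerset, F ω * G ω = ∑ ω ∈ E.powerset, (if b ∈ X ω ∧ b ∉ X (E \ ω) then ha (A ∪ X ω) * kb (A' ∪ X ω) else 0) := by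
      refine Finset.sum_congr rfl fun ω _ => ?_
      simp only [hF, hG]
      by_cases h1 : b ∈ X ω ∧ b ∉ X (E \ ω)
      · rw [if_pos h1, if_pos h1]
      · rw [if_neg h1, if_neg h1, mul_zero]
    linarith
  -- second cross term: Σ_B hᵇ(A′∪Y) kᵃ(A∪X) ≤ Σ_R hᵇ(A′∪X) kᵃ(A∪X)
  have cross2 : ∑ ω ∈ E.powerset, (if b ∈ X (E \ ω) ∧ b ∉ X ω then ka (A ∪ X ω) * hb (A' ∪ X (E \ ω)) else 0)
      ≤ ∑ ω ∈ E.powerset, (if b ∈ X ω ∧ b ∉ X (E \ ω) then ka (A ∪ X ω) * hb (A' ∪ X ω) else 0) := by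
    set F : Finset ι → ℝ := fun ω => ka (A ∪ X ω) with hF
    set G : Finset ι → ℝ := fun ω => if b ∈ X ω ∧ b ∉ X (E \ ω) then hb (A' ∪ X ω) else 0 with hG
    have hFm : Monotone F := fun ω ω' hle => mka (Set.union_subset_union_right A (hXmono hle))
    have hGm : Monotone G := by
      intro ω ω' hle
      simp only [hG]
      by_cases h1 : b ∈ X ω ∧ b ∉ X (E \ ω)
      · have h1' : b ∈ X ω' ∧ b ∉ X (E \ ω') := ⟨hXmono hle h1.1, fun hx => h1.2 (hXmono (Finset.sdiff_subset_sdiff (le_refl E) hle) hx)⟩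
        rw [if_pos h1, if_pos h1']
        exact mhb (Set.union_subset_union_right A' (hXmono hle))
      · rw [if_neg h1]
        by_cases h2 : b ∈ X ω' ∧ b ∉ X (E \ ω')
        · rw [if_pos h2]; exact hb0 _
        · rw [if_neg h2]
    have key := sum_mul_sdiff_le_sum_mul E F G hFm hGm
    have lhs : ∑ ω ∈ E.powerset, F ω * G (E \ ω) =
        ∑ ω ∈ E.powerset, (if b ∈ X (E \ ω) ∧ b ∉ X ω then ka (A ∪ X ω) * hb (A' ∪ X (E \ ω)) else 0) := by
      refine Finset.sum_congr rfl fun ω hω => ?_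
      simp only [hF, hG]
      rw [Finset.sdiff_sdiff_eq_self (Finset.mem_powerset.mp hω)]
      by_cases h1 : b ∈ X (E \ ω) ∧ b ∉ X ω
      · rw [if_pos h1, if_pos h1]
      · rw [if_neg h1, if_neg h1, mul_zero]
    have rhs : ∑ ω ∈ E.powerset, F ω * G ω = ∑ ω ∈ E.powerset, (if b ∈ X ω ∧ b ∉ X (E \ ω) then ka (A ∪ X ω) * hb (A' ∪ X ω) else 0) := by
      refine Finset.sum_congr rfl fun ω _ => ?_
      simp only [hF, hG]
      by_cases h1 : b ∈ X ω ∧ b ∉ X (E \ ω)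
      · rw [if_pos h1, if_pos h1]
      · rw [if_neg h1, if_neg h1, mul_zero]
    linarith
  -- termwise bookkeeping: B-terms ≥ square − cross₁ − cross₂ ; R-terms: supply − claimed = h·kᵇ + hᵇ·k − hᵇkᵇ ≥ cross bounds − square
  have tB : ∑ ω ∈ E.powerset, (if b ∈ X (E \ ω) ∧ b ∉ X ω then
        (ha (A ∪ X ω) - hb (A' ∪ X (E \ ω))) * (ka (A ∪ X ω) - kb (A' ∪ X (E \ ω))) else 0)
      ≥ ∑ ω ∈ E.powerset, (if b ∈ X (E \ ω) ∧ b ∉ X ω then hb (A' ∪ X (E \ ω)) * kb (A' ∪ X (E \ ω)) else 0)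
        - ∑ ω ∈ E.powerset, (if b ∈ X (E \ ω) ∧ b ∉ X ω then ha (A ∪ X ω) * kb (A' ∪ X (E \ ω)) else 0)
        - ∑ ω ∈ E.powerset, (if b ∈ X (E \ ω) ∧ b ∉ X ω then ka (A ∪ X ω) * hb (A' ∪ X (E \ ω)) else 0) := by
    rw [ge_iff_le, ← Finset.sum_sub_distrib, ← Finset.sum_sub_distrib]
    refine Finset.sum_le_sum fun ω _ => ?_
    by_cases h1 : b ∈ X (E \ ω) ∧ b ∉ X ω
    · rw [if_pos h1, if_pos h1, if_pos h1, if_pos h1]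
      have e : (ha (A ∪ X ω) - hb (A' ∪ X (E \ ω))) * (ka (A ∪ X ω) - kb (A' ∪ X (E \ ω))) =
          ha (A ∪ X ω) * ka (A ∪ X ω) + hb (A' ∪ X (E \ ω)) * kb (A' ∪ X (E \ ω))
            - ha (A ∪ X ω) * kb (A' ∪ X (E \ ω)) - ka (A ∪ X ω) * hb (A' ∪ X (E \ ω)) := by ring
      rw [e]
      linarith [mul_nonneg (ha0 (A ∪ X ω)) (ka0 (A ∪ X ω))]
    · rw [if_neg h1, if_neg h1, if_neg h1, if_neg h1]; linarith
  have tR : ∑ ω ∈ E.powerset, (if b ∈ X ω ∧ b ∉ X (E \ ω) then h (A ∪ X ω) * k (A ∪ X ω) else 0)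
      - ∑ ω ∈ E.powerset, (if b ∈ X ω ∧ b ∉ X (E \ ω) then (h (A ∪ X ω) - hb (A' ∪ X ω)) * (k (A ∪ X ω) - kb (A' ∪ X ω)) else 0)
      ≥ ∑ ω ∈ E.powerset, (if b ∈ X ω ∧ b ∉ X (E \ ω) then ha (A ∪ X ω) * kb (A' ∪ X ω) else 0)
        + ∑ ω ∈ E.powerset, (if b ∈ X ω ∧ b ∉ X (E \ ω) then ka (A ∪ X ω) * hb (A' ∪ X ω) else 0)
        - ∑ ω ∈ E.powerset, (if b ∈ X ω ∧ b ∉ X (E \ ω) then hb (A' ∪ X ω) * kb (A' ∪ X ω) else 0) := by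
    rw [ge_iff_le, ← Finset.sum_sub_distrib, ← Finset.sum_add_distrib, ← Finset.sum_sub_distrib]
    refine Finset.sum_le_sum fun ω _ => ?_
    by_cases h1 : b ∈ X ω ∧ b ∉ X (E \ ω)
    · rw [if_pos h1, if_pos h1, if_pos h1, if_pos h1, if_pos h1]
      have e : h (A ∪ X ω) * k (A ∪ X ω) - (h (A ∪ X ω) - hb (A' ∪ X ω)) * (k (A ∪ X ω) - kb (A' ∪ X ω)) =
          h (A ∪ X ω) * kb (A' ∪ X ω) + k (A ∪ X ω) * hb (A' ∪ X ω) - hb (A' ∪ X ω) * kb (A' ∪ X ω) := by ring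
      rw [e]
      have u1 : ha (A ∪ X ω) * kb (A' ∪ X ω) ≤ h (A ∪ X ω) * kb (A' ∪ X ω) := mul_le_mul_of_nonneg_right (hah _) (kb0 _)
      have u2 : ka (A ∪ X ω) * hb (A' ∪ X ω) ≤ k (A ∪ X ω) * hb (A' ∪ X ω) := mul_le_mul_of_nonneg_right (kak _) (hb0 _)
      linarith
    · rw [if_neg h1, if_neg h1, if_neg h1, if_neg h1, if_neg h1]; linarith
  rw [Finset.sum_add_distrib]
  linarith [sq, cross1, cross2, tB, tR]

open Classical in
/-- **The contact cell from the one-sided root inequality.**  Two edge sets `E₁, E₂` (any graph), cut vertex `c`, observers `a` (for `E₁`) and `b` (for `E₂`);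
`Xᵢ(ωᵢ) = C_c(ωᵢ)`, `Yᵢ(ωᵢ) = C_c(Eᵢ∖ωᵢ)`; `R₁ = {a ∈ X₁ ∖ Y₁}`, `R₂ = {b ∈ X₂ ∖ Y₂}`, `B₂ = {b ∈ Y₂ ∖ X₂}`; monotone levels `0 ≤ hᵃ, hᵇ ≤ h`,
`0 ≤ kᵃ, kᵇ ≤ k`.  If the ONE-SIDED ROOT INEQUALITY holds for `(E₁; c, a)` — for all monotone `H ≥ Hᵇ ≥ 0`, `K ≥ Kᵇ ≥ 0`:
`Σ_{R₁} (H(X₁) − Hᵇ(Y₁))(K(X₁) − Kᵇ(Y₁)) ≥ 0` — then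
`0 ≤ Σ_{ω₁ ∈ R₁} Σ_{ω₂} [ 1_{R₂} h(X₁∪X₂)k(X₁∪X₂) + 1_{B₂} (hᵃ(X₁∪X₂) − hᵇ(Y₁∪Y₂))(kᵃ(X₁∪X₂) − kᵇ(Y₁∪Y₂)) ]`.
[cite: KozmaNitzan2024, Questions 8–9 (§5.5 p. 36) (context)] -/
theorem seriesC6_of_oneSidedRoot (ends : ι → Sym2 V) (E₁ E₂ : Finset ι) (c a b : V) (h k ha hb ka kb : Set V → ℝ)
    (hh : Monotone h) (hk : Monotone k) (mha : Monotone ha) (mhb : Monotone hb) (mka : Monotone ka) (mkb : Monotone kb)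
    (ha0 : ∀ X, 0 ≤ ha X) (hah : ∀ X, ha X ≤ h X) (hb0 : ∀ X, 0 ≤ hb X) (hbh : ∀ X, hb X ≤ h X)
    (ka0 : ∀ X, 0 ≤ ka X) (kak : ∀ X, ka X ≤ k X) (kb0 : ∀ X, 0 ≤ kb X) (kbk : ∀ X, kb X ≤ k X)
    (hOSR : ∀ H Hb K Kb : Set V → ℝ, Monotone H → Monotone Hb → Monotone K → Monotone Kb →
      (∀ X, 0 ≤ Hb X) → (∀ X, Hb X ≤ H X) → (∀ X, 0 ≤ Kb X) → (∀ X, Kb X ≤ K X) →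
      0 ≤ ∑ ω₁ ∈ E₁.powerset, (if a ∈ openCluster (ends '' (↑ω₁ : Set ι)) c ∧ a ∉ openCluster (ends '' (↑(E₁ \ ω₁) : Set ι)) c then
        (H (openCluster (ends '' (↑ω₁ : Set ι)) c) - Hb (openCluster (ends '' (↑(E₁ \ ω₁) : Set ι)) c)) *
          (K (openCluster (ends '' (↑ω₁ : Set ι)) c) - Kb (openCluster (ends '' (↑(E₁ \ ω₁) : Set ι)) c)) else 0)) :
    0 ≤ ∑ ω₁ ∈ E₁.powerset, (if a ∈ openCluster (ends '' (↑ω₁ : Set ι)) c ∧ a ∉ openCluster (ends '' (↑(E₁ \ ω₁) : Set ι)) c then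
      ∑ ω₂ ∈ E₂.powerset,
        ((if b ∈ openCluster (ends '' (↑ω₂ : Set ι)) c ∧ b ∉ openCluster (ends '' (↑(E₂ \ ω₂) : Set ι)) c then
            h (openCluster (ends '' (↑ω₁ : Set ι)) c ∪ openCluster (ends '' (↑ω₂ : Set ι)) c) *
              k (openCluster (ends '' (↑ω₁ : Set ι)) c ∪ openCluster (ends '' (↑ω₂ : Set ι)) c) else 0)
        + (if b ∈ openCluster (ends '' (↑(E₂ \ ω₂) : Set ι)) c ∧ b ∉ openCluster (ends '' (↑ω₂ : Set ι)) c then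
            (ha (openCluster (ends '' (↑ω₁ : Set ι)) c ∪ openCluster (ends '' (↑ω₂ : Set ι)) c) -
                hb (openCluster (ends '' (↑(E₁ \ ω₁) : Set ι)) c ∪ openCluster (ends '' (↑(E₂ \ ω₂) : Set ι)) c)) *
              (ka (openCluster (ends '' (↑ω₁ : Set ι)) c ∪ openCluster (ends '' (↑ω₂ : Set ι)) c) -
                kb (openCluster (ends '' (↑(E₁ \ ω₁) : Set ι)) c ∪ openCluster (ends '' (↑(E₂ \ ω₂) : Set ι)) c)) else 0))
      else 0) := by
  set X : Finset ι → Set V := fun ω => openCluster (ends '' (↑ω : Set ι)) c with hX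
  change 0 ≤ ∑ ω₁ ∈ E₁.powerset, (if a ∈ X ω₁ ∧ a ∉ X (E₁ \ ω₁) then
      ∑ ω₂ ∈ E₂.powerset, ((if b ∈ X ω₂ ∧ b ∉ X (E₂ \ ω₂) then h (X ω₁ ∪ X ω₂) * k (X ω₁ ∪ X ω₂) else 0)
        + (if b ∈ X (E₂ \ ω₂) ∧ b ∉ X ω₂ then (ha (X ω₁ ∪ X ω₂) - hb (X (E₁ \ ω₁) ∪ X (E₂ \ ω₂))) * (ka (X ω₁ ∪ X ω₂) - kb (X (E₁ \ ω₁) ∪ X (E₂ \ ω₂))) else 0))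
      else 0)
  change ∀ H Hb K Kb : Set V → ℝ, Monotone H → Monotone Hb → Monotone K → Monotone Kb →
      (∀ X, 0 ≤ Hb X) → (∀ X, Hb X ≤ H X) → (∀ X, 0 ≤ Kb X) → (∀ X, Kb X ≤ K X) →
      0 ≤ ∑ ω₁ ∈ E₁.powerset, (if a ∈ X ω₁ ∧ a ∉ X (E₁ \ ω₁) then (H (X ω₁) - Hb (X (E₁ \ ω₁))) * (K (X ω₁) - Kb (X (E₁ \ ω₁))) else 0) at hOSR
  -- step 1: per ω₁, the one-root transfer on E₂ with A = X ω₁, A' = X (E₁ \ ω₁)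
  have step1 : ∀ ω₁, (∑ ω₂ ∈ E₂.powerset, (if b ∈ X ω₂ ∧ b ∉ X (E₂ \ ω₂) then
        (h (X ω₁ ∪ X ω₂) - hb (X (E₁ \ ω₁) ∪ X ω₂)) * (k (X ω₁ ∪ X ω₂) - kb (X (E₁ \ ω₁) ∪ X ω₂)) else 0))
      ≤ ∑ ω₂ ∈ E₂.powerset, ((if b ∈ X ω₂ ∧ b ∉ X (E₂ \ ω₂) then h (X ω₁ ∪ X ω₂) * k (X ω₁ ∪ X ω₂) else 0)
        + (if b ∈ X (E₂ \ ω₂) ∧ b ∉ X ω₂ then (ha (X ω₁ ∪ X ω₂) - hb (X (E₁ \ ω₁) ∪ X (E₂ \ ω₂))) * (ka (X ω₁ ∪ X ω₂) - kb (X (E₁ \ ω₁) ∪ X (E₂ \ ω₂))) else 0)) :=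
    fun ω₁ => oneRoot_transfer ends E₂ c b (X ω₁) (X (E₁ \ ω₁)) h k ha ka hb kb mha mka mhb mkb ha0 hah ka0 kak hb0 kb0
  -- step 2: lower bound by the double sum of shifted one-sided root terms
  have step2 : ∑ ω₁ ∈ E₁.powerset, (if a ∈ X ω₁ ∧ a ∉ X (E₁ \ ω₁) then
        ∑ ω₂ ∈ E₂.powerset, (if b ∈ X ω₂ ∧ b ∉ X (E₂ \ ω₂) then
          (h (X ω₁ ∪ X ω₂) - hb (X (E₁ \ ω₁) ∪ X ω₂)) * (k (X ω₁ ∪ X ω₂) - kb (X (E₁ \ ω₁) ∪ X ω₂)) else 0) else 0)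
      ≤ ∑ ω₁ ∈ E₁.powerset, (if a ∈ X ω₁ ∧ a ∉ X (E₁ \ ω₁) then
        ∑ ω₂ ∈ E₂.powerset, ((if b ∈ X ω₂ ∧ b ∉ X (E₂ \ ω₂) then h (X ω₁ ∪ X ω₂) * k (X ω₁ ∪ X ω₂) else 0)
          + (if b ∈ X (E₂ \ ω₂) ∧ b ∉ X ω₂ then (ha (X ω₁ ∪ X ω₂) - hb (X (E₁ \ ω₁) ∪ X (E₂ \ ω₂))) * (ka (X ω₁ ∪ X ω₂) - kb (X (E₁ \ ω₁) ∪ X (E₂ \ ω₂))) else 0))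
        else 0) := by
    refine Finset.sum_le_sum fun ω₁ _ => ?_
    by_cases h1 : a ∈ X ω₁ ∧ a ∉ X (E₁ \ ω₁)
    · rw [if_pos h1, if_pos h1]; exact step1 ω₁
    · rw [if_neg h1, if_neg h1]
  -- step 3: exchange the sums; each inner sum over ω₁ is an instance of the one-sided root inequality with levels shifted by X ω₂
  have step3 : 0 ≤ ∑ ω₁ ∈ E₁.powerset, (if a ∈ X ω₁ ∧ a ∉ X (E₁ \ ω₁) then
        ∑ ω₂ ∈ E₂.powerset, (if b ∈ X ω₂ ∧ b ∉ X (E₂ \ ω₂) then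
          (h (X ω₁ ∪ X ω₂) - hb (X (E₁ \ ω₁) ∪ X ω₂)) * (k (X ω₁ ∪ X ω₂) - kb (X (E₁ \ ω₁) ∪ X ω₂)) else 0) else 0) := by
    have hcomm : ∑ ω₁ ∈ E₁.powerset, (if a ∈ X ω₁ ∧ a ∉ X (E₁ \ ω₁) then
        ∑ ω₂ ∈ E₂.powerset, (if b ∈ X ω₂ ∧ b ∉ X (E₂ \ ω₂) then
          (h (X ω₁ ∪ X ω₂) - hb (X (E₁ \ ω₁) ∪ X ω₂)) * (k (X ω₁ ∪ X ω₂) - kb (X (E₁ \ ω₁) ∪ X ω₂)) else 0) else 0)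
        = ∑ ω₂ ∈ E₂.powerset, (if b ∈ X ω₂ ∧ b ∉ X (E₂ \ ω₂) then
          ∑ ω₁ ∈ E₁.powerset, (if a ∈ X ω₁ ∧ a ∉ X (E₁ \ ω₁) then
            (h (X ω₁ ∪ X ω₂) - hb (X (E₁ \ ω₁) ∪ X ω₂)) * (k (X ω₁ ∪ X ω₂) - kb (X (E₁ \ ω₁) ∪ X ω₂)) else 0) else 0) := by
      have e1 : ∑ ω₁ ∈ E₁.powerset, (if a ∈ X ω₁ ∧ a ∉ X (E₁ \ ω₁) then
          ∑ ω₂ ∈ E₂.powerset, (if b ∈ X ω₂ ∧ b ∉ X (E₂ \ ω₂) then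
            (h (X ω₁ ∪ X ω₂) - hb (X (E₁ \ ω₁) ∪ X ω₂)) * (k (X ω₁ ∪ X ω₂) - kb (X (E₁ \ ω₁) ∪ X ω₂)) else 0) else 0)
          = ∑ ω₁ ∈ E₁.powerset, ∑ ω₂ ∈ E₂.powerset, (if (a ∈ X ω₁ ∧ a ∉ X (E₁ \ ω₁)) ∧ (b ∈ X ω₂ ∧ b ∉ X (E₂ \ ω₂)) then
            (h (X ω₁ ∪ X ω₂) - hb (X (E₁ \ ω₁) ∪ X ω₂)) * (k (X ω₁ ∪ X ω₂) - kb (X (E₁ \ ω₁) ∪ X ω₂)) else 0) := by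
        refine Finset.sum_congr rfl fun ω₁ _ => ?_
        by_cases h1 : a ∈ X ω₁ ∧ a ∉ X (E₁ \ ω₁)
        · rw [if_pos h1]
          refine Finset.sum_congr rfl fun ω₂ _ => ?_
          by_cases h2 : b ∈ X ω₂ ∧ b ∉ X (E₂ \ ω₂)
          · rw [if_pos h2, if_pos ⟨h1, h2⟩]
          · rw [if_neg h2, if_neg (fun hx => h2 hx.2)]
        · rw [if_neg h1]
          symm
          exact Finset.sum_eq_zero fun ω₂ _ => by rw [if_neg (fun hx => h1 hx.1)]
      have e2 : ∑ ω₂ ∈ E₂.powerset, (if b ∈ X ω₂ ∧ b ∉ X (E₂ \ ω₂) then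
          ∑ ω₁ ∈ E₁.powerset, (if a ∈ X ω₁ ∧ a ∉ X (E₁ \ ω₁) then
            (h (X ω₁ ∪ X ω₂) - hb (X (E₁ \ ω₁) ∪ X ω₂)) * (k (X ω₁ ∪ X ω₂) - kb (X (E₁ \ ω₁) ∪ X ω₂)) else 0) else 0)
          = ∑ ω₂ ∈ E₂.powerset, ∑ ω₁ ∈ E₁.powerset, (if (a ∈ X ω₁ ∧ a ∉ X (E₁ \ ω₁)) ∧ (b ∈ X ω₂ ∧ b ∉ X (E₂ \ ω₂)) then
            (h (X ω₁ ∪ X ω₂) - hb (X (E₁ \ ω₁) ∪ X ω₂)) * (k (X ω₁ ∪ X ω₂) - kb (X (E₁ \ ω₁) ∪ X ω₂)) else 0) := by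
        refine Finset.sum_congr rfl fun ω₂ _ => ?_
        by_cases h2 : b ∈ X ω₂ ∧ b ∉ X (E₂ \ ω₂)
        · rw [if_pos h2]
          refine Finset.sum_congr rfl fun ω₁ _ => ?_
          by_cases h1 : a ∈ X ω₁ ∧ a ∉ X (E₁ \ ω₁)
          · rw [if_pos h1, if_pos ⟨h1, h2⟩]
          · rw [if_neg h1, if_neg (fun hx => h1 hx.1)]
        · rw [if_neg h2]
          symm
          exact Finset.sum_eq_zero fun ω₁ _ => by rw [if_neg (fun hx => h2 hx.2)]
      rw [e1, e2, Finset.sum_comm]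
    rw [hcomm]
    refine Finset.sum_nonneg fun ω₂ _ => ?_
    by_cases h2 : b ∈ X ω₂ ∧ b ∉ X (E₂ \ ω₂)
    · rw [if_pos h2]
      exact hOSR (fun U => h (U ∪ X ω₂)) (fun U => hb (U ∪ X ω₂)) (fun U => k (U ∪ X ω₂)) (fun U => kb (U ∪ X ω₂))
        (fun U U' hU => hh (Set.union_subset_union_left _ hU)) (fun U U' hU => mhb (Set.union_subset_union_left _ hU))
        (fun U U' hU => hk (Set.union_subset_union_left _ hU)) (fun U U' hU => mkb (Set.union_subset_union_left _ hU))
        (fun U => hb0 _) (fun U => hbh _) (fun U => kb0 _) (fun U => kbk _)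
    · rw [if_neg h2]
  linarith [step2, step3]

end Coefficientwise

end Summit.CriticalPhenomena.PercolationContinuityZ3.Theorems
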